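import Mathlib
import Summits.MatrixMultiplication.MatrixMultiplication.Theorems.LevelGradedCohnUmansLevelOneGL2DesignsParabolaLift
import Summits.MatrixMultiplication.MatrixMultiplication.Theorems.LevelGradedCohnUmansLevelOneGL2DesignsSqrtNegTwoLiftDigits

/-!
# The `√-2` parabola lift: strong representative systems of size `≫ p^{5/4}` for `p ≡ 1, 3 (mod 8)`

Twin of `…GaussLift.lean` (wall-breaker seat k2/12, stub `stub_tangencySets` of the crux `LevelOneGL2Designs`,
stmt-MatrixMultiplication-14080) with `ℤ[i]` replaced by `ℤ[√-2]`: for the primes with `-2` a square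
(`p ≡ 1, 3 (mod 8)`, Mathlib's `ZMod.exists_sq_eq_neg_two_iff`) the map `φ(a + b√-2) = a + b·r`, `r² = -2`,
has no wrap-around on the window `u² + 2v² < p` (`sqrtNegTwo_noWrap`: `u ≡ -vr` gives `u² ≡ -2v²`), and
lifting a box `[0,B)²` times the square-difference-free set of `exists_sqrtNegTwoSqDiffFree` (exponent
`3/4`, base `3` split) gives

* `sqrtNegTwoLift` — `r² = -2`, `B² ≤ L`, `9^t ≤ L`, `48·L² ≤ p` ⇒ a strong representative system of size
  exactly `B²·27^t` in the stub's dot-product format;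
* `tangencySet_five_fourths_of_mod_eight` — for every prime `p ≡ 1` or `3 (mod 8)` one of size
  `≥ p^{5/4} / 120000`.

Together with `tangencySet_five_fourths` (`p ≡ 1 mod 4`) this covers all primes `p ≢ 7 (mod 8)` with
explicit constants; the remaining class `p ≡ 7 (mod 8)` (via the real ring `ℤ[√2]`) and the all-primes
statement are wall-breaker k8's `QuadraticLift.exists_srs_card_ge_rpow_five_fourths`
(`…QuadraticLiftExponent.lean`, via Mathlib's `Zsqrtd`), not restated here.  See `NumberRingLift.md`
(evidence on the item).  No definitions.
-/

-- justification: the summit/problem path `MatrixMultiplication.MatrixMultiplication` is fixed by the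
-- tree layout (D-0017), so the namespace necessarily repeats a component.
set_option linter.dupNamespace false

noncomputable section

open Finset Matrix

namespace Summit.MatrixMultiplication.MatrixMultiplication.Theorems.LevelOneGL2Designs.ParabolaLift

section Lift

variable {p : ℕ} [Fact p.Prime]

/-- **No wrap-around for the `√-2` window.**  If `s² = -2` in `𝔽_p` and `u + v·s = 0` for integers with
`u² + 2v² < p`, then `u = v = 0` (because `p ∣ u² + 2v²`, the norm of `u + v√-2`). [elementary] -/
theorem sqrtNegTwo_noWrap (s : ZMod p) (hs : s ^ 2 = -2) (u v : ℤ) (hlt : u ^ 2 + 2 * v ^ 2 < p)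
    (h : (u : ZMod p) + v * s = 0) : u = 0 ∧ v = 0 := by
  have hu : (u : ZMod p) = -(v * s) := eq_neg_of_add_eq_zero_left h
  have hsq : ((u ^ 2 + 2 * v ^ 2 : ℤ) : ZMod p) = 0 := by
    push_cast
    rw [hu]
    linear_combination (v : ZMod p) ^ 2 * hs
  have hdvd : (p : ℤ) ∣ u ^ 2 + 2 * v ^ 2 := (ZMod.intCast_zmod_eq_zero_iff_dvd _ p).mp hsq
  have h0 : u ^ 2 + 2 * v ^ 2 = 0 := by
    apply Int.eq_zero_of_abs_lt_dvd hdvd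
    rw [abs_of_nonneg (by positivity)]
    exact hlt
  constructor <;> nlinarith [sq_nonneg u, sq_nonneg v]

/-- The square of `φ(a + b√-2) = a + b·s` is `(a² - 2b²) + 2ab·s` when `s² = -2`. [elementary] -/
theorem sqrtNegTwo_phi_sq (s : ZMod p) (hs : s ^ 2 = -2) (a b : ℤ) :
    ((a : ZMod p) + b * s) ^ 2 = ((a ^ 2 - 2 * b ^ 2 : ℤ) : ZMod p) + ((2 * a * b : ℤ) : ZMod p) * s := by
  push_cast
  linear_combination (b : ZMod p) ^ 2 * hs

/-- **The `√-2` parabola lift.**  Let `s² = -2` in `𝔽_p` and let `B, t, L` satisfy `B² ≤ L`, `9^t ≤ L`,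
`48·L² ≤ p`.  Then there is a strong representative system of `AG(2,p)` in the format of
`stub_tangencySets` of size exactly `B²·27^t` (parameters `(φ x, φ(k + 2L))`, `x ∈ [0,B)² ⊆ ℤ[√-2]`, `k` in
the set of `exists_sqrtNegTwoSqDiffFree`). [elementary; new] -/
theorem sqrtNegTwoLift (s : ZMod p) (hs : s ^ 2 = -2) (B t L : ℕ) (hB : B ^ 2 ≤ L) (ht : 9 ^ t ≤ L)
    (hL : 48 * L ^ 2 ≤ p) :
    ∃ S : Finset ((Fin 2 → ZMod p) × (Fin 2 → ZMod p)), S.card = B ^ 2 * 27 ^ t ∧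
      ∀ f ∈ S, ∀ f' ∈ S, (dotProduct f.1 f'.2 = 1 ↔ f = f') := by
  classical
  obtain ⟨K, hKcard, hKW, hK⟩ := exists_sqrtNegTwoSqDiffFree t
  -- integer bookkeeping
  have hLZ : (48 : ℤ) * (L : ℤ) ^ 2 ≤ p := by exact_mod_cast hL
  have hBZ : ((B : ℤ)) ^ 2 ≤ L := by exact_mod_cast hB
  have htZ : ((9 : ℤ)) ^ t ≤ L := by exact_mod_cast ht
  have hL2 : (L : ℤ) ≤ 48 * (L : ℤ) ^ 2 := by nlinarith
  -- the window lemma in the form used below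
  have win : ∀ u v : ℤ, -(5 * (L : ℤ)) < u → u < 5 * L → -(3 * (L : ℤ)) < v → v < 3 * L →
      (u : ZMod p) + v * s = 0 → u = 0 ∧ v = 0 := by
    intro u v hu1 hu2 hv1 hv2 h
    refine sqrtNegTwo_noWrap s hs u v ?_ h
    have hu : u ^ 2 < 25 * (L : ℤ) ^ 2 + 1 := by nlinarith
    have hv : v ^ 2 < 9 * (L : ℤ) ^ 2 + 1 := by nlinarith
    have : u ^ 2 + 2 * v ^ 2 ≤ 43 * (L : ℤ) ^ 2 + 2 := by linarith
    nlinarith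
  -- the map
  let Φ : (ℕ × ℕ) × (ℕ × ℕ) → ZMod p × ZMod p := fun y =>
    (((y.1.1 : ℤ) : ZMod p) + ((y.1.2 : ℤ) : ZMod p) * s,
      (((y.2.1 : ℤ) + 2 * L : ℤ) : ZMod p) + ((y.2.2 : ℤ) : ZMod p) * s)
  let Dom : Finset ((ℕ × ℕ) × (ℕ × ℕ)) := (range B ×ˢ range B) ×ˢ K
  have hinj : Set.InjOn Φ ↑Dom := by
    rintro ⟨⟨a, b⟩, ⟨k₁, k₂⟩⟩ h ⟨⟨a', b'⟩, ⟨k₁', k₂'⟩⟩ h' heq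
    simp only [Dom, coe_product, coe_range, Set.mem_prod, Set.mem_Iio, mem_coe] at h h'
    obtain ⟨⟨ha, hb⟩, hk⟩ := h
    obtain ⟨⟨ha', hb'⟩, hk'⟩ := h'
    have hkW := hKW _ hk
    have hkW' := hKW _ hk'
    simp only [Φ, Prod.mk.injEq] at heq
    obtain ⟨hx, hy⟩ := heq
    have e1 : (((a : ℤ) - a' : ℤ) : ZMod p) + (((b : ℤ) - b' : ℤ) : ZMod p) * s = 0 := by
      push_cast at hx ⊢
      linear_combination hx
    have e2 : (((k₁ : ℤ) - k₁' : ℤ) : ZMod p) + (((k₂ : ℤ) - k₂' : ℤ) : ZMod p) * s = 0 := by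
      push_cast at hy ⊢
      linear_combination hy
    have hkW1 : (k₁ : ℤ) < 9 ^ t ∧ (k₂ : ℤ) < 9 ^ t := ⟨by exact_mod_cast hkW.1, by exact_mod_cast hkW.2⟩
    have hkW2 : (k₁' : ℤ) < 9 ^ t ∧ (k₂' : ℤ) < 9 ^ t := ⟨by exact_mod_cast hkW'.1, by exact_mod_cast hkW'.2⟩
    have haZ : (a : ℤ) < B ∧ (a' : ℤ) < B ∧ (b : ℤ) < B ∧ (b' : ℤ) < B :=
      ⟨by exact_mod_cast ha, by exact_mod_cast ha', by exact_mod_cast hb, by exact_mod_cast hb'⟩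
    have hBL : (B : ℤ) ≤ L := by nlinarith
    obtain ⟨h1, h2⟩ := win _ _ (by linarith) (by linarith) (by linarith) (by linarith) e1
    obtain ⟨h3, h4⟩ := win _ _ (by linarith) (by linarith) (by linarith) (by linarith) e2
    have : a = a' := by omega
    have : b = b' := by omega
    have : k₁ = k₁' := by omega
    have : k₂ = k₂' := by omega
    subst a'; subst b'; subst k₁'; subst k₂'
    rfl
  set T : Finset (ZMod p × ZMod p) := Dom.image Φ with hTdef
  have hTcard : T.card = B ^ 2 * 27 ^ t := by
    rw [hTdef, card_image_of_injOn hinj]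
    simp only [Dom, card_product, card_range, hKcard]
    ring
  -- parabola-freeness
  have hfree : ∀ q ∈ T, ∀ q' ∈ T, (q'.1 - q.1) ^ 2 = q.2 - q'.2 → q'.1 = q.1 := by
    intro q hq q' hq' hrel
    simp only [hTdef, mem_image, Dom, mem_product, mem_range, Prod.exists] at hq hq'
    obtain ⟨a, b, k₁, k₂, ⟨⟨ha, hb⟩, hk⟩, rfl⟩ := hq
    obtain ⟨a', b', k₁', k₂', ⟨⟨ha', hb'⟩, hk'⟩, rfl⟩ := hq'
    simp only [Φ] at hrel ⊢
    -- `hrel : (φ x' - φ x)² = φ k̃ - φ k̃'`; rewrite the left side with `sqrtNegTwo_phi_sq`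
    obtain ⟨α, hα⟩ : ∃ α : ℤ, α = (a' : ℤ) - a := ⟨_, rfl⟩
    obtain ⟨β, hβ⟩ : ∃ β : ℤ, β = (b' : ℤ) - b := ⟨_, rfl⟩
    have hsq := sqrtNegTwo_phi_sq s hs α β
    have e : (((α ^ 2 - 2 * β ^ 2) - ((k₁ : ℤ) - k₁') : ℤ) : ZMod p) +
        (((2 * α * β) - ((k₂ : ℤ) - k₂') : ℤ) : ZMod p) * s = 0 := by
      have hl : (((a' : ℤ) : ZMod p) + ((b' : ℤ) : ZMod p) * s -
          (((a : ℤ) : ZMod p) + ((b : ℤ) : ZMod p) * s)) = ((α : ZMod p) + (β : ZMod p) * s) := by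
        rw [hα, hβ]; push_cast; ring
      rw [hl, hsq] at hrel
      push_cast at hrel ⊢
      linear_combination hrel
    have hkW1 : (k₁ : ℤ) < 9 ^ t ∧ (k₂ : ℤ) < 9 ^ t :=
      ⟨by exact_mod_cast (hKW _ hk).1, by exact_mod_cast (hKW _ hk).2⟩
    have hkW2 : (k₁' : ℤ) < 9 ^ t ∧ (k₂' : ℤ) < 9 ^ t :=
      ⟨by exact_mod_cast (hKW _ hk').1, by exact_mod_cast (hKW _ hk').2⟩
    have ha1 : (a : ℤ) < B := by exact_mod_cast ha
    have ha2 : (a' : ℤ) < B := by exact_mod_cast ha'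
    have hb1 : (b : ℤ) < B := by exact_mod_cast hb
    have hb2 : (b' : ℤ) < B := by exact_mod_cast hb'
    have ha0 : (0 : ℤ) ≤ a := by positivity
    have ha0' : (0 : ℤ) ≤ a' := by positivity
    have hb0 : (0 : ℤ) ≤ b := by positivity
    have hb0' : (0 : ℤ) ≤ b' := by positivity
    have hk0 : (0 : ℤ) ≤ k₁ := by positivity
    have hk0' : (0 : ℤ) ≤ k₁' := by positivity
    have hk0'' : (0 : ℤ) ≤ k₂ := by positivity
    have hk0''' : (0 : ℤ) ≤ k₂' := by positivity
    have hαb : -(B : ℤ) < α ∧ α < B := by rw [hα]; constructor <;> linarith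
    have hβb : -(B : ℤ) < β ∧ β < B := by rw [hβ]; constructor <;> linarith
    have hα2 : α ^ 2 < (B : ℤ) ^ 2 := sq_lt_sq' hαb.1 hαb.2
    have hβ2 : β ^ 2 < (B : ℤ) ^ 2 := sq_lt_sq' hβb.1 hβb.2
    have hαβabs : |α * β| < (B : ℤ) * B := by
      rw [abs_mul]
      exact mul_lt_mul'' (abs_lt.mpr hαb) (abs_lt.mpr hβb) (abs_nonneg _) (abs_nonneg _)
    obtain ⟨hαβ1, hαβ2⟩ := abs_lt.mp hαβabs
    have hsα := sq_nonneg α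
    have hsβ := sq_nonneg β
    have hB2 : (B : ℤ) * B = (B : ℤ) ^ 2 := by ring
    obtain ⟨h1, h2⟩ := win _ _ (by linarith) (by linarith) (by linarith) (by linarith) e
    obtain ⟨hα0, hβ0⟩ := hK (k₁, k₂) hk (k₁', k₂') hk' α β (by push_cast; linarith)
      (by push_cast; linarith)
    have haa : (a' : ℤ) = a := by rw [hα0] at hα; linarith
    have hbb : (b' : ℤ) = b := by rw [hβ0] at hβ; linarith
    have ha'' : a' = a := by exact_mod_cast haa
    have hb'' : b' = b := by exact_mod_cast hbb
    rw [ha'', hb'']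
  -- all tangents avoid the origin: `φ k̃ ≠ (φ x)²`
  have hoff : ∀ q ∈ T, q.2 ≠ q.1 ^ 2 := by
    intro q hq
    simp only [hTdef, mem_image, Dom, mem_product, mem_range, Prod.exists] at hq
    obtain ⟨a, b, k₁, k₂, ⟨⟨ha, hb⟩, hk⟩, rfl⟩ := hq
    simp only [Φ]
    intro h
    rw [sqrtNegTwo_phi_sq s hs] at h
    have e : ((((k₁ : ℤ) + 2 * L) - ((a : ℤ) ^ 2 - 2 * b ^ 2) : ℤ) : ZMod p) +
        (((k₂ : ℤ) - 2 * a * b : ℤ) : ZMod p) * s = 0 := by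
      push_cast at h ⊢
      linear_combination h
    have hkW1 : (k₁ : ℤ) < 9 ^ t ∧ (k₂ : ℤ) < 9 ^ t :=
      ⟨by exact_mod_cast (hKW _ hk).1, by exact_mod_cast (hKW _ hk).2⟩
    have ha1 : (a : ℤ) < B := by exact_mod_cast ha
    have hb1 : (b : ℤ) < B := by exact_mod_cast hb
    have ha0 : (0 : ℤ) ≤ a := by positivity
    have hb0 : (0 : ℤ) ≤ b := by positivity
    have hk0 : (0 : ℤ) ≤ k₁ := by positivity
    have hk0' : (0 : ℤ) ≤ k₂ := by positivity
    have ha2 : (a : ℤ) ^ 2 < (B : ℤ) ^ 2 := pow_lt_pow_left₀ ha1 ha0 two_ne_zero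
    have hb2 : (b : ℤ) ^ 2 < (B : ℤ) ^ 2 := pow_lt_pow_left₀ hb1 hb0 two_ne_zero
    have hab : (a : ℤ) * b < (B : ℤ) * B := mul_lt_mul'' ha1 hb1 ha0 hb0
    have hB2 : (B : ℤ) * B = (B : ℤ) ^ 2 := by ring
    have hsa := sq_nonneg (a : ℤ)
    have hsb := sq_nonneg (b : ℤ)
    have hab0 : (0 : ℤ) ≤ (a : ℤ) * b := by positivity
    obtain ⟨h1, -⟩ := win _ _ (by linarith) (by linarith) (by linarith) (by linarith) e
    linarith
  obtain ⟨S, hS, hprop⟩ := tangency_of_parabolaFree T hfree hoff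
  exact ⟨S, hS.trans hTcard, hprop⟩

end Lift

section Exponent

/-- **Exponent `5/4` for every prime `p ≡ 1, 3 (mod 8)`.**  For every such prime there is a strong
representative system of `AG(2,p)` in the format of `stub_tangencySets` with at least `p^{5/4} / 120000`
flags (`sqrtNegTwoLift` with `L = ⌊√p⌋/7`, `B = ⌊√L⌋`, `9^t ≤ L < 9^{t+1}`; primes below `49` are served by a
single flag).  New for `p ≡ 3 (mod 8)`; for `p ≡ 1 (mod 8)` see also `tangencySet_five_fourths`.
[elementary; new] -/
theorem tangencySet_five_fourths_of_mod_eight (p : ℕ) [Fact p.Prime] (hp8 : p % 8 = 1 ∨ p % 8 = 3) :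
    ∃ S : Finset ((Fin 2 → ZMod p) × (Fin 2 → ZMod p)),
      (1 / 120000 : ℝ) * (p : ℝ) ^ (5 / 4 : ℝ) ≤ S.card ∧
      ∀ f ∈ S, ∀ f' ∈ S, (dotProduct f.1 f'.2 = 1 ↔ f = f') := by
  classical
  have hp1 : (1 : ℝ) ≤ p := by exact_mod_cast (Fact.out : p.Prime).one_lt.le
  have hp0 : (0 : ℝ) < p := by linarith
  by_cases h49 : 49 ≤ p
  swap
  · -- small primes: one flag
    refine ⟨{(![1, 0], ![1, 0])}, ?_, ?_⟩
    · rw [Finset.card_singleton, Nat.cast_one]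
      have h1 : (p : ℝ) ^ (5 / 4 : ℝ) ≤ (p : ℝ) ^ ((2 : ℕ) : ℝ) :=
        Real.rpow_le_rpow_of_exponent_le hp1 (by norm_num)
      rw [Real.rpow_natCast] at h1
      have h2 : (p : ℝ) < 49 := by exact_mod_cast (not_le.mp h49)
      nlinarith
    · intro f hf f' hf'
      rw [Finset.mem_singleton] at hf hf'
      subst hf
      subst hf'
      simp [dotProduct, Fin.sum_univ_two]
  -- the parameters
  set q := Nat.sqrt p with hq
  set L := q / 7 with hLdef
  set B := Nat.sqrt L with hBdef
  set t := Nat.log 9 L with htdef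
  have hq7 : 7 ≤ q := by
    rw [hq, Nat.le_sqrt]
    omega
  have hL1 : 1 ≤ L := by omega
  have hqq : q * q ≤ p := Nat.sqrt_le p
  have h7L : 7 * L ≤ q := by omega
  have hLp : 48 * L ^ 2 ≤ p := by nlinarith
  have hB : B ^ 2 ≤ L := Nat.sqrt_le' L
  have ht : 9 ^ t ≤ L := Nat.pow_log_le_self 9 (by omega)
  have hp2 : p ≠ 2 := by omega
  obtain ⟨s, hs⟩ : IsSquare (-2 : ZMod p) := (ZMod.exists_sq_eq_neg_two_iff hp2).mpr hp8
  obtain ⟨S, hScard, hS⟩ := sqrtNegTwoLift s (by rw [hs]; ring) B t L hB ht hLp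
  refine ⟨S, ?_, hS⟩
  rw [hScard]
  push_cast
  -- numerical constants `9^{3/2} = 27`, `16^{5/2} = 1024`
  have h27c : (9 : ℝ) ^ (3 / 2 : ℝ) = 27 := by
    rw [show (9 : ℝ) = (3 : ℝ) ^ (2 : ℕ) by norm_num, ← Real.rpow_natCast,
      ← Real.rpow_mul (by norm_num)]
    norm_num
  have h1024 : (16 : ℝ) ^ (5 / 2 : ℝ) = 1024 := by
    rw [show (16 : ℝ) = (4 : ℝ) ^ (2 : ℕ) by norm_num, ← Real.rpow_natCast,
      ← Real.rpow_mul (by norm_num)]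
    norm_num
  -- real estimates: `L ≥ √p/16`, `B² ≥ L/4`, `27^t > (L/9)^{3/2}`
  have hL0 : (0 : ℝ) < L := by exact_mod_cast hL1
  have hLR : Real.sqrt p / 16 ≤ L := by
    have hlt : p < (q + 1) ^ 2 := Nat.lt_succ_sqrt' p
    have hltR : (p : ℝ) < ((q : ℝ) + 1) ^ 2 := by exact_mod_cast hlt
    have hsq : Real.sqrt p < q + 1 := by
      rw [Real.sqrt_lt' (by positivity)]
      exact hltR
    have h7 : (q : ℝ) ≤ 7 * L + 6 := by
      have : q ≤ 7 * L + 6 := by omega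
      exact_mod_cast this
    have hL1R : (1 : ℝ) ≤ L := by exact_mod_cast hL1
    by_cases h16 : Real.sqrt p ≤ 16
    · linarith
    · linarith
  have hBR : (L : ℝ) / 4 ≤ (B : ℝ) ^ 2 := by
    have hlt : L < (B + 1) ^ 2 := Nat.lt_succ_sqrt' L
    have hltR : (L : ℝ) < ((B : ℝ) + 1) ^ 2 := by exact_mod_cast hlt
    have hsq : Real.sqrt L < B + 1 := by
      rw [Real.sqrt_lt' (by positivity)]
      exact hltR
    have hB1 : (1 : ℝ) ≤ B := by exact_mod_cast Nat.sqrt_pos.mpr hL1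
    have h2B : Real.sqrt L ≤ 2 * B := by
      by_cases h2 : Real.sqrt L ≤ 2
      · linarith
      · linarith
    have hsqL : Real.sqrt L ^ 2 = L := Real.sq_sqrt hL0.le
    nlinarith [Real.sqrt_nonneg (L : ℝ)]
  have h27 : ((L : ℝ) / 9) ^ (3 / 2 : ℝ) ≤ (27 : ℝ) ^ t := by
    have hlt : L < 9 ^ (t + 1) := Nat.lt_pow_succ_log_self (by norm_num) L
    have hltR : (L : ℝ) < 9 * (9 : ℝ) ^ t := by
      have : (L : ℝ) < ((9 ^ (t + 1) : ℕ) : ℝ) := by exact_mod_cast hlt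
      rw [Nat.cast_pow, pow_succ] at this
      push_cast at this
      linarith
    have hdiv : (L : ℝ) / 9 ≤ (9 : ℝ) ^ t := by
      rw [div_le_iff₀ (by norm_num : (0 : ℝ) < 9)]
      linarith
    calc ((L : ℝ) / 9) ^ (3 / 2 : ℝ) ≤ ((9 : ℝ) ^ t) ^ (3 / 2 : ℝ) :=
          Real.rpow_le_rpow (by positivity) hdiv (by norm_num)
      _ = (27 : ℝ) ^ t := by
          rw [← Real.rpow_natCast 9 t, ← Real.rpow_mul (by norm_num), mul_comm,
            Real.rpow_mul (by norm_num), h27c, Real.rpow_natCast]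
  have hLpow : (L : ℝ) ^ (5 / 2 : ℝ) = L * ((L : ℝ) ^ (3 / 2 : ℝ)) := by
    rw [show (5 / 2 : ℝ) = 1 + 3 / 2 by norm_num, Real.rpow_add hL0, Real.rpow_one]
  have hdivpow : ((L : ℝ) / 9) ^ (3 / 2 : ℝ) = (L : ℝ) ^ (3 / 2 : ℝ) / 27 := by
    rw [Real.div_rpow hL0.le (by norm_num), h27c]
  have step1 : (L : ℝ) ^ (5 / 2 : ℝ) ≤ 108 * ((B : ℝ) ^ 2 * (27 : ℝ) ^ t) := by
    rw [hLpow]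
    rw [hdivpow] at h27
    have hA : (0 : ℝ) ≤ (L : ℝ) ^ (3 / 2 : ℝ) := by positivity
    have hBB : (0 : ℝ) ≤ (B : ℝ) ^ 2 := by positivity
    calc (L : ℝ) * (L : ℝ) ^ (3 / 2 : ℝ) = 108 * (((L : ℝ) / 4) * ((L : ℝ) ^ (3 / 2 : ℝ) / 27)) := by
          ring
      _ ≤ 108 * ((B : ℝ) ^ 2 * (27 : ℝ) ^ t) := by
          gcongr
  have step2 : (p : ℝ) ^ (5 / 4 : ℝ) ≤ 1024 * (L : ℝ) ^ (5 / 2 : ℝ) := by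
    have hmono : (Real.sqrt p / 16) ^ (5 / 2 : ℝ) ≤ (L : ℝ) ^ (5 / 2 : ℝ) :=
      Real.rpow_le_rpow (by positivity) hLR (by norm_num)
    have hsplit : (Real.sqrt p / 16) ^ (5 / 2 : ℝ) = (p : ℝ) ^ (5 / 4 : ℝ) / 1024 := by
      rw [Real.div_rpow (Real.sqrt_nonneg _) (by norm_num), h1024,
        Real.sqrt_eq_rpow, ← Real.rpow_mul hp0.le]
      norm_num
    rw [hsplit] at hmono
    have : (p : ℝ) ^ (5 / 4 : ℝ) / 1024 * 1024 = (p : ℝ) ^ (5 / 4 : ℝ) := by field_simp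
    nlinarith [hmono]
  have hpos : (0 : ℝ) ≤ (p : ℝ) ^ (5 / 4 : ℝ) := by positivity
  nlinarith [step1, step2]

end Exponent

end Summit.MatrixMultiplication.MatrixMultiplication.Theorems.LevelOneGL2Designs.ParabolaLift
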